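import Literature.NumberTheory.LFunctions.FordLemma33A
import Mathlib.Algebra.Order.Chebyshev
import Mathlib.Algebra.Polynomial.Degree.SmallDegree
import HarnessLib

/-!
# Ford's Lemma 3.3 (the differencing step `L_s → K_s` of Wooley's method), complete

Topic `Literature/NumberTheory/LFunctions`. Everything here is PROVED.

K. Ford, Proc. LMS 85 (2002), Lemma 3.3, second half of the proof (the case `U₁`: every
`w_i ≠ z_i`, `w_i = z_i + h_i p^r`, `1 ≤ |h_i| ≤ P/p^r`) and the assembly with the first half
(`FordLemma33A.lean`: the case `U₀`):

*for a system `Φ` of type `(d,T)` (`T ≥ 1`), `P ≥ 1`, `p ≥ 1`, moduli `q ≠ 0` and any `r`, there is a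
system `Υ` of type `(d+1,T')` with `T ≤ T' ≤ PT` such that*
`L_s(P,Q;Φ;p,q,r) ≤ (2P)^k max[k^k J_{s,k}(Q), 2 p^{-rk} (J_{s,k}(Q) K_s(P,Q;Υ;pq))^{1/2}]`
(`FordVK.ford_lemma33`; in fact with `⌊(P−1)/p^r⌋^k` in place of `(P/p^r)^k`,
`FordVK.ford_lemma33_sharp`). Here `Υ_j(z) = Φ_j(z + hp^r) − Φ_j(z)` (`j ≥ d+2`), `Υ_j = 0`
(`j ≤ d+1`) for a suitable `1 ≤ h ≤ (P−1)/p^r` (`FordVK.diffSys`), exactly as printed; the primality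
of `p` and the side conditions `s ≥ d`, `r ≥ 2` of the printed statement are not needed.

Proof (as printed, with the bookkeeping made explicit): `L = U₀ + U₁`. For `U₁`, split by the
sign pattern of `w_i − z_i` (`2^k` patterns); for a fixed pattern the solutions inject into the
solutions of `∑_i ±(Φ(b_i + h_i p^r) − Φ(b_i)) + (pq)^j ∑ (x_i^j − y_i^j) = 0`, `b_i ≤ P`,
`1 ≤ h_i ≤ H = ⌊(P−1)/p^r⌋`, whose number is `∫ ∏_i G(±α) |f(α)|^{2s} dα ≤ ∫ |G|^k |f|^{2s}` with
`G = ∑_{h ≤ H} g_h`, `g_h(α) = ∑_{b ≤ P} e(α·(Φ(b+hp^r) − Φ(b)))`; then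
`|G|^k ≤ H^{k−1} ∑_h |g_h|^k` (power mean), Cauchy–Schwarz
`∫ |g_h|^k |f|^{2s} ≤ (∫ |g_h|^{2k}|f|^{2s})^{1/2} (∫ |f|^{2s})^{1/2} = (K_s(P,Q;Υ_h;pq) J_{s,k}(Q))^{1/2}`
(`|g_h| = |F(α;P;Υ_h)|` since `Φ_{d+1}(b + y) − Φ_{d+1}(b)` does not depend on `b`), and the worst
`h` is taken. With `U₀ ≤ kP L^{1−1/k} J^{1/k}` (`FordLemma33A`) and `L ≤ 2 max(U₀, U₁)` the lemma
follows.

## References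

* K. Ford, *Vinogradov's integral and bounds for the Riemann zeta function*, Proc. London Math.
  Soc. (3) 85 (2002), 565–633; arXiv:1910.08209 — Lemma 3.3 and its proof. [Ford2002]
-/

noncomputable section

open Finset MeasureTheory Polynomial Complex
open scoped Real ComplexConjugate

namespace Literature.NumberTheory.LFunctions
namespace FordVK

open VMV

/-! ### Small analytic and algebraic pieces -/

/-- A shifted trigonometric polynomial: `∑_b e(α·(v(b) + c)) = e(α·c) ∑_b e(α·v(b))`. [folklore] -/
theorem tp_add_const {n : ℕ} {ι : Type*} (S : Finset ι) (v : ι → Fin n → ℤ) (c : Fin n → ℤ)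
    (α : Fin n → ℝ) : tp S (fun b => v b + c) α = E c α * tp S v α := by
  unfold tp
  rw [mul_sum]
  refine sum_congr rfl fun b _ => ?_
  rw [E_add, mul_comm]

/-- `‖∑_b e(α·(v(b) + c))‖ = ‖∑_b e(α·v(b))‖`. [folklore] -/
theorem norm_tp_add_const {n : ℕ} {ι : Type*} (S : Finset ι) (v : ι → Fin n → ℤ) (c : Fin n → ℤ)
    (α : Fin n → ℝ) : ‖tp S (fun b => v b + c) α‖ = ‖tp S v α‖ := by
  rw [tp_add_const, norm_mul, norm_E, one_mul]

/-- `‖∑_b e(−α·v(b))‖ = ‖∑_b e(α·v(b))‖`. [cite: Ford2002, proof of Lemma 3.3 ("Since |g(α;h)| = |g(−α;h)|")] -/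
theorem norm_tp_neg {n : ℕ} {ι : Type*} (S : Finset ι) (v : ι → Fin n → ℤ) (α : Fin n → ℝ) :
    ‖tp S (fun b => -v b) α‖ = ‖tp S v α‖ := by
  rw [← conj_tp, Complex.norm_conj]

/-- A trigonometric polynomial over a product set, summed over the second coordinate first. [folklore] -/
theorem tp_product_right {n : ℕ} {ι κ : Type*} (S : Finset ι) (S' : Finset κ) (v : ι × κ → Fin n → ℤ)
    (α : Fin n → ℝ) : tp (S ×ˢ S') v α = ∑ h ∈ S', tp S (fun b => v (b, h)) α := by
  unfold tp
  rw [sum_product_right]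

/-- For a polynomial of degree `1`, `Φ(b + y) − Φ(b) = lead(Φ) · y` does not depend on `b`. [folklore] -/
theorem eval_add_sub_eval_of_natDegree_eq_one {Φ : ℤ[X]} (h : Φ.natDegree = 1) (b y : ℤ) :
    Φ.eval (b + y) - Φ.eval b = Φ.leadingCoeff * y := by
  have e := eq_X_add_C_of_natDegree_le_one (le_of_eq h)
  have hl : Φ.leadingCoeff = Φ.coeff 1 := by rw [leadingCoeff, h]
  rw [hl]
  conv_lhs => rw [e]
  simp only [eval_add, eval_mul, eval_C, eval_X]
  ring

/-- Power mean: `(∑_{h∈S} a_h)^k ≤ |S|^{k−1} ∑_h a_h^k` for `a_h ≥ 0`, `k ≥ 1`. [folklore] -/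
theorem pow_sum_le_card_pow_mul_sum_pow {ι : Type*} (S : Finset ι) {a : ι → ℝ} (ha : ∀ h ∈ S, 0 ≤ a h)
    {k : ℕ} (hk : 1 ≤ k) : (∑ h ∈ S, a h) ^ k ≤ (S.card : ℝ) ^ (k - 1) * ∑ h ∈ S, a h ^ k := by
  obtain ⟨n, rfl⟩ : ∃ n, k = n + 1 := ⟨k - 1, by omega⟩
  rw [Nat.add_sub_cancel]
  exact pow_sum_le_card_mul_sum_pow ha n

/-- Cauchy–Schwarz on the box for continuous nonnegative functions:
`∫ F G ≤ (∫ F²)^{1/2} (∫ G²)^{1/2}`. [folklore] -/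
theorem cauchy_schwarz_box {n : ℕ} {F G : (Fin n → ℝ) → ℝ} (hF : Continuous F) (hG : Continuous G)
    (hF0 : ∀ α, 0 ≤ F α) (hG0 : ∀ α, 0 ≤ G α) :
    ∫ α in box n, F α * G α
      ≤ Real.sqrt (∫ α in box n, F α ^ 2) * Real.sqrt (∫ α in box n, G α ^ 2) := by
  have h := holder_box hF hG hF0 hG0 Real.HolderConjugate.two_two
  simp_rw [Real.rpow_two] at h
  rw [Real.sqrt_eq_rpow, Real.sqrt_eq_rpow]
  exact h

/-! ### The differencing step: notation -/

section U1

variable {k : ℕ} (s P Q : ℕ) (Φ : PSystem k) (q : ℤ) (p r : ℕ)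

/-- `H = ⌊(P−1)/p^r⌋`, the range of the shifts `h` in `w = z ± h p^r`. [cite: Ford2002, proof of
Lemma 3.3 ("w_i = z_i + h_i p^r, where 1 ≤ |h_i| ≤ P/p^r")] -/
def Hsh : ℕ := (P - 1) / p ^ r

/-- The difference frequencies `(Φ_j(b + h p^r) − Φ_j(b))_j`. [cite: Ford2002, proof of Lemma 3.3 (`g(α;h)`)] -/
def dvec (bh : ℤ × ℤ) : Fin k → ℤ := sysv Φ (bh.1 + bh.2 * (p : ℤ) ^ r) - sysv Φ bh.1

/-- The index set of the pairs `(b, h)`, `1 ≤ b ≤ P`, `1 ≤ h ≤ H`. [folklore] -/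
def BH : Finset (ℤ × ℤ) := Finset.Icc 1 (P : ℤ) ×ˢ Finset.Icc 1 (Hsh P p r : ℤ)

/-- Ford's `g(α;h) = ∑_{b ≤ P} e(α·(Φ(b + hp^r) − Φ(b)))`. [cite: Ford2002, proof of Lemma 3.3 (`g(α;h)`)] -/
def gsh (h : ℤ) (α : Fin k → ℝ) : ℂ := tp (Finset.Icc 1 (P : ℤ)) (fun b => dvec Φ p r (b, h)) α

/-- `G(α) = ∑_{h ≤ H} g(α;h)`. [folklore] -/
def Gsh (α : Fin k → ℝ) : ℂ := tp (BH P p r) (dvec Φ p r) α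

omit s Q q in
/-- `G = ∑_h g_h`. [folklore] -/
theorem Gsh_eq_sum (α : Fin k → ℝ) : Gsh P Φ p r α = ∑ h ∈ Finset.Icc 1 (Hsh P p r : ℤ), gsh P Φ p r h α := by
  rw [Gsh, BH, tp_product_right]; rfl

omit s Q q in
/-- `‖G‖ ≤ ∑_h ‖g_h‖`. [cite: Ford2002, proof of Lemma 3.3 (the display bounding `∑_h |g(η₁α;h₁)⋯|`)] -/
theorem norm_Gsh_le (α : Fin k → ℝ) :
    ‖Gsh P Φ p r α‖ ≤ ∑ h ∈ Finset.Icc 1 (Hsh P p r : ℤ), ‖gsh P Φ p r h α‖ := by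
  rw [Gsh_eq_sum]; exact norm_sum_le _ _

omit s Q q in
/-- **Power mean**: `‖G‖^k ≤ H^{k−1} ∑_h ‖g_h‖^k` (`k ≥ 1`). [cite: Ford2002, proof of Lemma 3.3
("≤ (P/p^r)^k max_h |g(α;h)|^k")] -/
theorem norm_Gsh_pow_le (hk : 1 ≤ k) (α : Fin k → ℝ) :
    ‖Gsh P Φ p r α‖ ^ k ≤ (Hsh P p r : ℝ) ^ (k - 1) * ∑ h ∈ Finset.Icc 1 (Hsh P p r : ℤ), ‖gsh P Φ p r h α‖ ^ k := by
  have h1 : ‖Gsh P Φ p r α‖ ^ k ≤ (∑ h ∈ Finset.Icc 1 (Hsh P p r : ℤ), ‖gsh P Φ p r h α‖) ^ k :=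
    pow_le_pow_left₀ (norm_nonneg _) (norm_Gsh_le P Φ p r α) k
  refine h1.trans ?_
  have h2 := pow_sum_le_card_pow_mul_sum_pow (Finset.Icc 1 (Hsh P p r : ℤ)) (a := fun h => ‖gsh P Φ p r h α‖)
    (fun h _ => norm_nonneg _) hk
  have hc : ((Finset.Icc 1 (Hsh P p r : ℤ)).card : ℝ) = Hsh P p r := by
    rw [Int.card_Icc]; simp
  rw [hc] at h2
  exact h2

/-! ### `|g_h| = |F(·; Υ_h)|` -/

/-- The constant vector by which `Φ(b+y) − Φ(b)` and `Υ(b)` differ: only the entry `j = d+1`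
(`Φ_{d+1}` is linear). [cite: Ford2002, proof of Lemma 3.3 ("Υ_j(z) ≡ 0 for j ≤ d+1")] -/
def cvec (d : ℕ) (y : ℤ) : Fin k → ℤ := fun j => if j.val + 1 = d + 1 then (Φ j).leadingCoeff * y else 0

omit s P Q q p r in
/-- `Φ(b + y) − Φ(b) = Υ(b) + c` with `Υ = diffSys d y Φ`, for `Φ` of type `(d,T)`. [cite: Ford2002,
proof of Lemma 3.3 (definition of `Υ`)] -/
theorem sysv_shift_sub {d T m : ℕ} (hΦ : IsType Φ d T m) (y b : ℤ) :
    sysv Φ (b + y) - sysv Φ b = sysv (diffSys d y Φ) b + cvec Φ d y := by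
  funext j
  simp only [Pi.sub_apply, Pi.add_apply, sysv, cvec]
  rcases Nat.lt_trichotomy (j.val + 1) (d + 1) with hlt | heq | hgt
  · -- `Φ_j = 0`
    rw [hΦ.zero j (by omega), diffSys_of_le d y Φ j hlt.le, if_neg (by omega)]; simp
  · -- `Φ_{d+1}` is linear
    rw [diffSys_of_le d y Φ j heq.le, if_pos heq, eval_zero, zero_add]
    exact eval_add_sub_eval_of_natDegree_eq_one (by rw [hΦ.deg j (by omega)]; omega) b y
  · rw [diffSys_eval d y Φ j hgt, if_neg (by omega), add_zero]

omit s Q q in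
/-- **`|g(α;h)| = |F(α;P;Υ_h)|`** with `Υ_h = diffSys d (hp^r) Φ`. [cite: Ford2002, proof of Lemma 3.3
("∫ |g(α;h)|^{2k} |f(α)|^{2s} dα = K_s(P,Q;Υ;pq)")] -/
theorem norm_gsh_eq {d T m : ℕ} (hΦ : IsType Φ d T m) (h : ℤ) (α : Fin k → ℝ) :
    ‖gsh P Φ p r h α‖ = absF P (diffSys d (h * (p : ℤ) ^ r) Φ) α := by
  rw [gsh, absF]
  have e : (fun b : ℤ => dvec Φ p r (b, h)) = fun b => sysv (diffSys d (h * (p : ℤ) ^ r) Φ) b + cvec Φ d (h * (p : ℤ) ^ r) := by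
    funext b; exact sysv_shift_sub Φ hΦ _ b
  rw [e, norm_tp_add_const]

/-! ### The solution sets -/

/-- `U₁`: the solutions of (3.2) with `w_i ≠ z_i` for every `i`. [cite: Ford2002, proof of Lemma 3.3 (`U₁`)] -/
def U1set : Finset (((Fin k → ℤ) × (Fin s → ℤ)) × ((Fin k → ℤ) × (Fin s → ℤ))) :=
  (LIset s P Q Φ q p r k).filter fun a => ∀ i, a.1.1 i ≠ a.2.1 i

/-- `U₀`: the solutions of (3.2) with `w_i = z_i` for some `i`. [cite: Ford2002, proof of Lemma 3.3 (`U₀`)] -/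
def U0set : Finset (((Fin k → ℤ) × (Fin s → ℤ)) × ((Fin k → ℤ) × (Fin s → ℤ))) :=
  (LIset s P Q Φ q p r k).filter fun a => ∃ i, a.1.1 i = a.2.1 i

/-- `L = U₀ + U₁`. [cite: Ford2002, proof of Lemma 3.3 ("L ≤ 2 max(U₀,U₁)")] -/
theorem LI_eq_U0_add_U1 : LI s P Q Φ q p r k = (U0set s P Q Φ q p r).card + (U1set s P Q Φ q p r).card := by
  classical
  rw [LI, U0set, U1set, ← Finset.card_filter_add_card_filter_not (p := fun a => ∃ i, a.1.1 i = a.2.1 i)]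
  congr 2
  refine filter_congr fun a _ => ?_
  push Not; exact Iff.rfl

/-- The sign `∓1` attached to a coordinate: `−1` where `z_i < w_i`, `+1` where `w_i < z_i`. [folklore] -/
def sgnv (σ : Fin k → Bool) (i : Fin k) : ℤ := if σ i then -1 else 1

/-- The relaxed solution set for a fixed sign pattern `σ`: tuples `(b, h) ∈ ([1,P] × [1,H])^k`,
`x, y ∈ [1,Q]^s` with `∑_i ∓(Φ(b_i + h_i p^r) − Φ(b_i)) + ∑ powv(x_i) = ∑ powv(y_i)`.
[cite: Ford2002, proof of Lemma 3.3 (the display with `∑_{η} ∫ ∑_h g(η₁α;h₁)⋯g(η_kα;h_k)|f|^{2s}`)] -/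
def Rset (σ : Fin k → Bool) : Finset (((Fin k → ℤ × ℤ) × (Fin s → ℤ)) × (Fin s → ℤ)) :=
  (((Fintype.piFinset fun _ : Fin k => BH P p r) ×ˢ tuples s (Finset.Icc 1 (Q : ℤ))) ×ˢ
      tuples s (Finset.Icc 1 (Q : ℤ))).filter fun c =>
    (∑ i, sgnv σ i • dvec Φ p r (c.1.1 i)) + tupSum (powv k q) c.1.2 = tupSum (powv k q) c.2

/-- The sign pattern of a solution. [folklore] -/
def pattern (a : ((Fin k → ℤ) × (Fin s → ℤ)) × ((Fin k → ℤ) × (Fin s → ℤ))) : Fin k → Bool :=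
  fun i => decide (a.1.1 i < a.2.1 i)

/-- The shift datum `(min(z_i,w_i), |w_i − z_i|/p^r)` of a coordinate. [folklore] -/
def shiftOf (a : ((Fin k → ℤ) × (Fin s → ℤ)) × ((Fin k → ℤ) × (Fin s → ℤ))) (i : Fin k) : ℤ × ℤ :=
  (min (a.1.1 i) (a.2.1 i), |a.2.1 i - a.1.1 i| / (p : ℤ) ^ r)

omit Φ q in
/-- Arithmetic of the shift: for `z ≠ w` in `[1,P]` with `p^r ∣ z − w`, `h = |w−z|/p^r` satisfies
`h p^r = |w − z|`, `1 ≤ h ≤ H`. [cite: Ford2002, proof of Lemma 3.3 ("1 ≤ |h_i| ≤ P/p^r")] -/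
theorem shift_props (hp : 0 < p) {z w : ℤ} (hz : z ∈ Finset.Icc 1 (P : ℤ)) (hw : w ∈ Finset.Icc 1 (P : ℤ))
    (hne : z ≠ w) (hdvd : ((p : ℤ) ^ r) ∣ z - w) :
    |w - z| / (p : ℤ) ^ r * (p : ℤ) ^ r = |w - z| ∧ 1 ≤ |w - z| / (p : ℤ) ^ r ∧
      |w - z| / (p : ℤ) ^ r ≤ (Hsh P p r : ℤ) := by
  have hM : (0 : ℤ) < (p : ℤ) ^ r := by positivity
  have hd : ((p : ℤ) ^ r) ∣ |w - z| := by
    rw [dvd_abs]; have := hdvd.neg_right; rwa [neg_sub] at this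
  have h1 : |w - z| / (p : ℤ) ^ r * (p : ℤ) ^ r = |w - z| := Int.ediv_mul_cancel hd
  have hpos : 0 < |w - z| := abs_pos.2 (sub_ne_zero.2 (Ne.symm hne))
  refine ⟨h1, ?_, ?_⟩
  · -- `h ≥ 1` since `h p^r = |w − z| > 0`
    by_contra hlt
    push Not at hlt
    have : |w - z| / (p : ℤ) ^ r * (p : ℤ) ^ r ≤ 0 := by nlinarith
    rw [h1] at this; linarith
  · rw [Finset.mem_Icc] at hz hw
    have hle : |w - z| ≤ (P : ℤ) - 1 := by rw [abs_le]; constructor <;> linarith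
    have hP1 : 1 ≤ P := by exact_mod_cast (hz.1.trans hz.2)
    have e : ((Hsh P p r : ℕ) : ℤ) = ((P : ℤ) - 1) / (p : ℤ) ^ r := by
      rw [Hsh, Int.natCast_div, Nat.cast_sub hP1]; simp
    rw [e]
    exact Int.ediv_le_ediv hM hle

/-- **The injection**: the solutions counted by `U₁` with sign pattern `σ` inject into the relaxed
solution set `Rset σ`. [cite: Ford2002, proof of Lemma 3.3 ("There are 2^k choices for the signs of
w_i − z_i … L ≤ 2 ∑_η ∫ ∑_h g(η₁α;h₁)⋯g(η_kα;h_k) |f(α)|^{2s} dα")] -/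
theorem card_U1_fiber_le (hp : 0 < p) (σ : Fin k → Bool) :
    ((U1set s P Q Φ q p r).filter fun a => pattern s a = σ).card ≤ (Rset s P Q Φ q p r σ).card := by
  classical
  -- the key per-coordinate facts
  have key : ∀ a ∈ (U1set s P Q Φ q p r).filter (fun a => pattern s a = σ), ∀ i,
      (shiftOf s p r a i ∈ BH P p r) ∧
      sgnv σ i • dvec Φ p r (shiftOf s p r a i) = sysv Φ (a.1.1 i) - sysv Φ (a.2.1 i) ∧
      (a.1.1 i = if σ i then (shiftOf s p r a i).1 else (shiftOf s p r a i).1 + (shiftOf s p r a i).2 * (p : ℤ) ^ r) ∧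
      (a.2.1 i = if σ i then (shiftOf s p r a i).1 + (shiftOf s p r a i).2 * (p : ℤ) ^ r else (shiftOf s p r a i).1) := by
    intro a ha i
    rw [mem_filter, U1set, mem_filter, mem_LIset] at ha
    obtain ⟨⟨⟨⟨⟨hz, -⟩, hw, -⟩, -, hcong⟩, hne⟩, hσ⟩ := ha
    have hzi := mem_tuples.1 hz i
    have hwi := mem_tuples.1 hw i
    obtain ⟨hmul, h1, hH⟩ := shift_props P p r hp hzi hwi (hne i) (hcong i)
    have hσi : σ i = decide (a.1.1 i < a.2.1 i) := by rw [← hσ]; rfl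
    have hmemBH : shiftOf s p r a i ∈ BH P p r := by
      rw [BH, shiftOf, mem_product, Finset.mem_Icc, Finset.mem_Icc]
      rw [Finset.mem_Icc] at hzi hwi
      refine ⟨⟨le_min hzi.1 hwi.1, min_le_of_left_le hzi.2⟩, h1, hH⟩
    by_cases hlt : a.1.1 i < a.2.1 i
    · -- `z < w`: base `z`, `w = z + h p^r`, sign `−1`
      have hσt : σ i = true := by rw [hσi, decide_eq_true hlt]
      have hmin : min (a.1.1 i) (a.2.1 i) = a.1.1 i := min_eq_left hlt.le
      have habs : |a.2.1 i - a.1.1 i| = a.2.1 i - a.1.1 i := abs_of_pos (sub_pos.2 hlt)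
      have hw_eq : a.1.1 i + |a.2.1 i - a.1.1 i| / (p : ℤ) ^ r * (p : ℤ) ^ r = a.2.1 i := by
        rw [hmul, habs]; ring
      have e1 : sgnv σ i = -1 := by simp [sgnv, hσt]
      have e2 : dvec Φ p r (shiftOf s p r a i) = sysv Φ (a.2.1 i) - sysv Φ (a.1.1 i) := by
        show sysv Φ (min (a.1.1 i) (a.2.1 i) + |a.2.1 i - a.1.1 i| / (p : ℤ) ^ r * (p : ℤ) ^ r)
          - sysv Φ (min (a.1.1 i) (a.2.1 i)) = _
        rw [hmin, hw_eq]
      refine ⟨hmemBH, ?_, ?_, ?_⟩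
      · rw [e1, e2, neg_one_zsmul, neg_sub]
      · rw [hσt, if_pos rfl]; show a.1.1 i = min (a.1.1 i) (a.2.1 i); rw [hmin]
      · rw [hσt, if_pos rfl]
        show a.2.1 i = min (a.1.1 i) (a.2.1 i) + |a.2.1 i - a.1.1 i| / (p : ℤ) ^ r * (p : ℤ) ^ r
        rw [hmin, hw_eq]
    · -- `w < z`: base `w`, `z = w + h p^r`, sign `+1`
      have hgt : a.2.1 i < a.1.1 i := lt_of_le_of_ne (not_lt.1 hlt) (Ne.symm (hne i))
      have hσf : σ i = false := by rw [hσi]; simp [hlt]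
      have hmin : min (a.1.1 i) (a.2.1 i) = a.2.1 i := min_eq_right hgt.le
      have habs : |a.2.1 i - a.1.1 i| = a.1.1 i - a.2.1 i := by
        rw [abs_sub_comm]; exact abs_of_pos (sub_pos.2 hgt)
      have hz_eq : a.2.1 i + |a.2.1 i - a.1.1 i| / (p : ℤ) ^ r * (p : ℤ) ^ r = a.1.1 i := by
        rw [hmul, habs]; ring
      have e1 : sgnv σ i = 1 := by simp [sgnv, hσf]
      have e2 : dvec Φ p r (shiftOf s p r a i) = sysv Φ (a.1.1 i) - sysv Φ (a.2.1 i) := by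
        show sysv Φ (min (a.1.1 i) (a.2.1 i) + |a.2.1 i - a.1.1 i| / (p : ℤ) ^ r * (p : ℤ) ^ r)
          - sysv Φ (min (a.1.1 i) (a.2.1 i)) = _
        rw [hmin, hz_eq]
      refine ⟨hmemBH, ?_, ?_, ?_⟩
      · rw [e1, e2, one_zsmul]
      · rw [hσf]; rw [if_neg (by decide)]
        show a.1.1 i = min (a.1.1 i) (a.2.1 i) + |a.2.1 i - a.1.1 i| / (p : ℤ) ^ r * (p : ℤ) ^ r
        rw [hmin, hz_eq]
      · rw [hσf]; rw [if_neg (by decide)]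
        show a.2.1 i = min (a.1.1 i) (a.2.1 i); rw [hmin]
  refine card_le_card_of_injOn (fun a => ((fun i => shiftOf s p r a i, a.1.2), a.2.2)) ?_ ?_
  · intro a ha
    have hk := key a ha
    rw [mem_coe, mem_filter, U1set, mem_filter, mem_LIset] at ha
    obtain ⟨⟨⟨⟨⟨-, hx⟩, -, hy⟩, heq, -⟩, -⟩, -⟩ := ha
    rw [mem_coe, Rset, mem_filter, mem_product, mem_product, Fintype.mem_piFinset]
    refine ⟨⟨⟨fun i => (hk i).1, hx⟩, hy⟩, ?_⟩
    -- the equation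
    have hsum : (∑ i, sgnv σ i • dvec Φ p r (shiftOf s p r a i)) = tupSum (sysv Φ) a.1.1 - tupSum (sysv Φ) a.2.1 := by
      simp only [tupSum, ← Finset.sum_sub_distrib]
      exact Finset.sum_congr rfl fun i _ => (hk i).2.1
    simp only [LfreqJ] at heq
    show (∑ i, sgnv σ i • dvec Φ p r (shiftOf s p r a i)) + tupSum (powv k q) a.1.2 = tupSum (powv k q) a.2.2
    rw [hsum]
    have := congrArg (fun v => v - tupSum (sysv Φ) a.2.1) heq
    rw [← sub_eq_zero]
    rw [← sub_eq_zero] at this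
    rw [← this]; abel
  · intro a ha b hb hab
    have hka := key a ha
    have hkb := key b hb
    simp only [Prod.mk.injEq] at hab
    obtain ⟨⟨hsh, hx⟩, hy⟩ := hab
    have hshi : ∀ i, shiftOf s p r a i = shiftOf s p r b i := fun i => congrFun hsh i
    refine Prod.ext (Prod.ext ?_ hx) (Prod.ext ?_ hy)
    · funext i; rw [(hka i).2.2.1, (hkb i).2.2.1, hshi i]
    · funext i; rw [(hka i).2.2.2, (hkb i).2.2.2, hshi i]

/-- **The relaxed count as an integral**: `#Rset(σ) ≤ ∫ |G(α)|^k |f(α)|^{2s} dα`. [cite: Ford2002,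
proof of Lemma 3.3 (the two displays with `g(η_iα;h_i)`)] -/
theorem card_Rset_le_integral (σ : Fin k → Bool) :
    ((Rset s P Q Φ q p r σ).card : ℝ) ≤ ∫ α in box k, ‖Gsh P Φ p r α‖ ^ k * absf Q q α ^ (2 * s) := by
  classical
  set IQ := Finset.Icc 1 (Q : ℤ) with hIQ
  set A := (Fintype.piFinset fun _ : Fin k => BH P p r) ×ˢ tuples s IQ with hA
  set v : (Fin k → ℤ × ℤ) × (Fin s → ℤ) → Fin k → ℤ :=
    fun c => (∑ i, sgnv σ i • dvec Φ p r (c.1 i)) + tupSum (powv k q) c.2 with hv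
  have hcount := integral_tp_mul_conj_tp (n := k) A (tuples s IQ) v (tupSum (powv k q))
  have hR : (Rset s P Q Φ q p r σ).card = ((A ×ˢ tuples s IQ).filter fun ii' => v ii'.1 = tupSum (powv k q) ii'.2).card := by
    rw [Rset]
  -- factorisation of `tp A v`
  have htpA : ∀ α, tp A v α = (∏ i, tp (BH P p r) (fun bh => sgnv σ i • dvec Φ p r bh) α) * tp IQ (powv k q) α ^ s := by
    intro α
    rw [hA, hv, ← tp_tuples_tupSum, prod_tp_eq, tp_mul]
  have hnormi : ∀ α i, ‖tp (BH P p r) (fun bh => sgnv σ i • dvec Φ p r bh) α‖ = ‖Gsh P Φ p r α‖ := by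
    intro α i
    rw [Gsh]
    cases hσ : σ i
    · have e : (fun bh => sgnv σ i • dvec Φ p r bh) = dvec Φ p r := by
        funext bh; simp [sgnv, hσ]
      rw [e]
    · have e : (fun bh => sgnv σ i • dvec Φ p r bh) = fun bh => -dvec Φ p r bh := by
        funext bh; simp [sgnv, hσ]
      rw [e]; exact norm_tp_neg _ _ _
  have hnorm : ∀ α, ‖tp A v α * conj (tp (tuples s IQ) (tupSum (powv k q)) α)‖
      = ‖Gsh P Φ p r α‖ ^ k * absf Q q α ^ (2 * s) := by
    intro α
    rw [norm_mul, Complex.norm_conj, htpA, tp_tuples_tupSum, norm_mul, norm_pow, Complex.norm_prod]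
    simp_rw [hnormi α]
    rw [prod_const, card_univ, Fintype.card_fin, absf, pow_mul, sq]; ring
  have h1 : ((Rset s P Q Φ q p r σ).card : ℝ)
      = ‖∫ α in box k, tp A v α * conj (tp (tuples s IQ) (tupSum (powv k q)) α)‖ := by
    rw [hcount, hR]; simp
  rw [h1]
  refine (norm_integral_le_integral_norm _).trans (le_of_eq ?_)
  exact setIntegral_congr_fun (measurableSet_box _) fun α _ => hnorm α

/-- **`U₁ ≤ 2^k ∫ |G|^k |f|^{2s}`.** [cite: Ford2002, proof of Lemma 3.3 ("There are 2^k choices for the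
signs of w_i − z_i")] -/
theorem card_U1_le_integral (hp : 0 < p) :
    ((U1set s P Q Φ q p r).card : ℝ) ≤ 2 ^ k * ∫ α in box k, ‖Gsh P Φ p r α‖ ^ k * absf Q q α ^ (2 * s) := by
  classical
  have hfib := card_eq_sum_card_fiberwise (s := U1set s P Q Φ q p r) (t := (univ : Finset (Fin k → Bool)))
    (f := pattern s) (fun a _ => mem_univ _)
  rw [hfib]; push_cast
  calc ∑ σ : Fin k → Bool, ((((U1set s P Q Φ q p r).filter fun a => pattern s a = σ).card : ℕ) : ℝ)
      ≤ ∑ _σ : Fin k → Bool, ∫ α in box k, ‖Gsh P Φ p r α‖ ^ k * absf Q q α ^ (2 * s) :=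
        sum_le_sum fun σ _ => le_trans (by exact_mod_cast card_U1_fiber_le s P Q Φ q p r hp σ)
          (card_Rset_le_integral s P Q Φ q p r σ)
    _ = 2 ^ k * ∫ α in box k, ‖Gsh P Φ p r α‖ ^ k * absf Q q α ^ (2 * s) := by
        rw [sum_const, card_univ, Fintype.card_fun, Fintype.card_bool, Fintype.card_fin, nsmul_eq_mul]
        push_cast; ring

/-! ### The analytic estimate of `∫ |G|^k |f|^{2s}` -/

/-- **`∫ |g_h|^k |f|^{2s} ≤ (K_s(P,Q;Υ_h;q) J_{s,k}(Q))^{1/2}`** (Cauchy–Schwarz). [cite: Ford2002, proof of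
Lemma 3.3 ("≤ (∫ |g(α;h)|^{2k}|f(α)|^{2s} dα)^{1/2} (∫ |f(α)|^{2s} dα)^{1/2} = (K_s(P,Q;Υ;pq) J_{s,k}(Q))^{1/2}")] -/
theorem integral_gsh_le {d T m : ℕ} (hΦ : IsType Φ d T m) (hq : q ≠ 0) (h : ℤ) :
    ∫ α in box k, ‖gsh P Φ p r h α‖ ^ k * absf Q q α ^ (2 * s)
      ≤ Real.sqrt (Ks s P Q (diffSys d (h * (p : ℤ) ^ r) Φ) q) * Real.sqrt (J k s (Finset.Icc 1 (Q : ℤ))) := by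
  set Υ := diffSys d (h * (p : ℤ) ^ r) Φ with hΥ
  have e1 : ∀ α, ‖gsh P Φ p r h α‖ ^ k * absf Q q α ^ (2 * s) = (absF P Υ α ^ k * absf Q q α ^ s) * absf Q q α ^ s := by
    intro α; rw [norm_gsh_eq P Φ p r hΦ h α, pow_mul, sq, ← hΥ]; ring
  simp_rw [e1]
  have hcs := cauchy_schwarz_box (n := k) (F := fun α => absF P Υ α ^ k * absf Q q α ^ s) (G := fun α => absf Q q α ^ s)
    (((continuous_absF P Υ).pow _).mul ((continuous_absf Q q).pow _)) ((continuous_absf Q q).pow _)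
    (fun α => mul_nonneg (pow_nonneg (absF_nonneg P Υ α) _) (pow_nonneg (absf_nonneg Q q α) _))
    (fun α => pow_nonneg (absf_nonneg Q q α) _)
  refine hcs.trans (le_of_eq ?_)
  congr 1
  · rw [Ks_eq_integral' s P Q Υ q]
    congr 1
    refine setIntegral_congr_fun (measurableSet_box _) fun α _ => ?_
    show (absF P Υ α ^ k * absf Q q α ^ s) ^ 2 = absF P Υ α ^ (2 * k) * absf Q q α ^ (2 * s)
    rw [mul_pow, ← pow_mul, ← pow_mul, mul_comm k 2, mul_comm s 2]
  · rw [J_eq_integral_absf s Q (k := k) hq]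
    congr 1
    refine setIntegral_congr_fun (measurableSet_box _) fun α _ => ?_
    show (absf Q q α ^ s) ^ 2 = absf Q q α ^ (2 * s)
    rw [← pow_mul, mul_comm s 2]

/-- **`∫ |G|^k |f|^{2s} ≤ H^{k−1} ∑_{h ≤ H} (K_s(P,Q;Υ_h;q) J_{s,k}(Q))^{1/2}`.** [cite: Ford2002, proof of
Lemma 3.3 (the last display of the proof)] -/
theorem integral_Gsh_le {d T m : ℕ} (hΦ : IsType Φ d T m) (hq : q ≠ 0) (hk : 1 ≤ k) :
    ∫ α in box k, ‖Gsh P Φ p r α‖ ^ k * absf Q q α ^ (2 * s)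
      ≤ (Hsh P p r : ℝ) ^ (k - 1) * ∑ h ∈ Finset.Icc 1 (Hsh P p r : ℤ),
          Real.sqrt (Ks s P Q (diffSys d (h * (p : ℤ) ^ r) Φ) q) * Real.sqrt (J k s (Finset.Icc 1 (Q : ℤ))) := by
  set S := Finset.Icc 1 (Hsh P p r : ℤ) with hS
  have hpt : ∀ α, ‖Gsh P Φ p r α‖ ^ k * absf Q q α ^ (2 * s)
      ≤ (Hsh P p r : ℝ) ^ (k - 1) * ∑ h ∈ S, ‖gsh P Φ p r h α‖ ^ k * absf Q q α ^ (2 * s) := by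
    intro α
    have := norm_Gsh_pow_le P Φ p r hk α
    calc ‖Gsh P Φ p r α‖ ^ k * absf Q q α ^ (2 * s)
        ≤ ((Hsh P p r : ℝ) ^ (k - 1) * ∑ h ∈ S, ‖gsh P Φ p r h α‖ ^ k) * absf Q q α ^ (2 * s) :=
          mul_le_mul_of_nonneg_right this (pow_nonneg (absf_nonneg Q q α) _)
      _ = _ := by rw [mul_assoc, Finset.sum_mul]
  have hint : ∀ h, IntegrableOn (fun α => ‖gsh P Φ p r h α‖ ^ k * absf Q q α ^ (2 * s)) (box k) := fun h =>
    integrableOn_box_of_continuous_real (((continuous_tp _ _).norm.pow _).mul ((continuous_absf Q q).pow _))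
  calc ∫ α in box k, ‖Gsh P Φ p r α‖ ^ k * absf Q q α ^ (2 * s)
      ≤ ∫ α in box k, (Hsh P p r : ℝ) ^ (k - 1) * ∑ h ∈ S, ‖gsh P Φ p r h α‖ ^ k * absf Q q α ^ (2 * s) := by
        refine setIntegral_mono_on ?_ ?_ (measurableSet_box _) fun α _ => hpt α
        · exact integrableOn_box_of_continuous_real
            (((continuous_tp _ _).norm.pow _).mul ((continuous_absf Q q).pow _))
        · exact integrableOn_box_of_continuous_real (continuous_const.mul
            (continuous_finsetSum S fun h _ => ((continuous_tp _ _).norm.pow _).mul ((continuous_absf Q q).pow _)))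
    _ = (Hsh P p r : ℝ) ^ (k - 1) * ∑ h ∈ S, ∫ α in box k, ‖gsh P Φ p r h α‖ ^ k * absf Q q α ^ (2 * s) := by
        rw [integral_const_mul, integral_finsetSum _ fun h _ => hint h]
    _ ≤ _ := by
        refine mul_le_mul_of_nonneg_left (sum_le_sum fun h _ => integral_gsh_le s P Q Φ q p r hΦ hq h) ?_
        positivity

end U1

/-! ### Lemma 3.3 -/

/-- From `L ≤ c L^{1−1/k} J^{1/k}` to `L ≤ c^k J` (`L, c, J ≥ 0`, `k ≥ 1`). [folklore] -/
theorem le_pow_mul_of_le_mul_rpow {L c J : ℝ} {k : ℕ} (hk : 1 ≤ k) (hL : 0 ≤ L) (hc : 0 ≤ c) (hJ : 0 ≤ J)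
    (h : L ≤ c * L ^ (1 - 1 / (k : ℝ)) * J ^ (1 / (k : ℝ))) : L ≤ c ^ k * J := by
  have hk0 : (0 : ℝ) < k := by exact_mod_cast hk
  rcases hL.eq_or_lt with hL0 | hLpos
  · rw [← hL0]; positivity
  -- divide by `L^{1-1/k}`
  have hLk : L ^ (1 / (k : ℝ)) ≤ c * J ^ (1 / (k : ℝ)) := by
    have hpos : 0 < L ^ (1 - 1 / (k : ℝ)) := Real.rpow_pos_of_pos hLpos _
    have e : L = L ^ (1 / (k : ℝ)) * L ^ (1 - 1 / (k : ℝ)) := by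
      rw [← Real.rpow_add hLpos]; norm_num
    rw [e] at h
    have h' : L ^ (1 / (k : ℝ)) * L ^ (1 - 1 / (k : ℝ)) ≤ (c * J ^ (1 / (k : ℝ))) * L ^ (1 - 1 / (k : ℝ)) := by
      calc _ ≤ c * (L ^ (1 / (k : ℝ)) * L ^ (1 - 1 / (k : ℝ))) ^ (1 - 1 / (k : ℝ)) * J ^ (1 / (k : ℝ)) := h
        _ = (c * J ^ (1 / (k : ℝ))) * L ^ (1 - 1 / (k : ℝ)) := by rw [← e]; ring
    exact le_of_mul_le_mul_right h' hpos
  -- raise to the `k`-th power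
  have h2 : (L ^ (1 / (k : ℝ))) ^ k ≤ (c * J ^ (1 / (k : ℝ))) ^ k :=
    pow_le_pow_left₀ (Real.rpow_nonneg hL _) hLk k
  have e1 : (L ^ (1 / (k : ℝ))) ^ k = L := by
    rw [← Real.rpow_natCast, ← Real.rpow_mul hL]; field_simp; exact Real.rpow_one L
  have e2 : (J ^ (1 / (k : ℝ))) ^ k = J := by
    rw [← Real.rpow_natCast, ← Real.rpow_mul hJ]; field_simp; exact Real.rpow_one J
  rw [e1, mul_pow, e2] at h2
  exact h2

/-- **Ford's Lemma 3.3 (sharp form, with `H = ⌊(P−1)/p^r⌋`).** Let `k = k'+2`, `Φ` of type `(d,T)`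
with `T ≥ 1`, `P ≥ 1`, `p ≥ 1`, `q ≠ 0`. Then there is a system `Υ` of type `(d+1,T')` with
`T ≤ T' ≤ PT` (namely `Υ_j(z) = Φ_j(z + hp^r) − Φ_j(z)` for `j ≥ d+2`, `Υ_j = 0` for `j ≤ d+1`, for
some `1 ≤ h ≤ H`, or `h p^r` replaced by `1` when `H = 0`) such that
`L_s(P,Q;Φ;p,q,r) ≤ max[(2kP)^k J_{s,k}(Q), 2^{k+1} H^k (J_{s,k}(Q) K_s(P,Q;Υ;pq))^{1/2}]`.
[cite: Ford2002, Lemma 3.3 (proof)] -/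
theorem ford_lemma33_sharp {k' d : ℕ} (s P Q : ℕ) (hP : 1 ≤ P) (Φ : PSystem (k' + 2)) {T m : ℕ}
    (hΦ : IsType Φ d T m) (hT : 1 ≤ T) {p : ℕ} (hp : 0 < p) {q : ℤ} (hq : q ≠ 0) (r : ℕ) :
    ∃ Υ : PSystem (k' + 2), (∃ T' m', IsType Υ (d + 1) T' m' ∧ T ≤ T' ∧ T' ≤ P * T) ∧
      (Ls s P Q Φ p q r : ℝ) ≤ max ((2 * ((k' : ℝ) + 2) * P) ^ (k' + 2) * J (k' + 2) s (Finset.Icc 1 (Q : ℤ)))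
        (2 ^ (k' + 3) * (Hsh P p r : ℝ) ^ (k' + 2) *
          Real.sqrt (J (k' + 2) s (Finset.Icc 1 (Q : ℤ)) * Ks s P Q Υ ((p : ℤ) * q))) := by
  classical
  have hT0 : T ≠ 0 := by omega
  have hpq : (p : ℤ) * q ≠ 0 := mul_ne_zero (by exact_mod_cast hp.ne') hq
  set qq : ℤ := (p : ℤ) * q with hqq
  set H := Hsh P p r with hH
  set Jv : ℝ := (J (k' + 2) s (Finset.Icc 1 (Q : ℤ)) : ℝ) with hJv
  have hJ0 : 0 ≤ Jv := by positivity
  -- the worst shift `h⋆` (or `y = 1` when there is no shift at all)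
  obtain ⟨y, hy1, hyP, hmax⟩ : ∃ y : ℕ, 1 ≤ y ∧ y ≤ P ∧ ∀ h ∈ Finset.Icc 1 (H : ℤ),
      Ks s P Q (diffSys d (h * (p : ℤ) ^ r) Φ) qq ≤ Ks s P Q (diffSys d (y : ℤ) Φ) qq := by
    by_cases hH0 : H = 0
    · refine ⟨1, le_rfl, hP, fun h hh => ?_⟩
      rw [hH0, Finset.mem_Icc] at hh; push_cast at hh; omega
    · have hne : (Finset.Icc 1 (H : ℤ)).Nonempty := ⟨1, by rw [Finset.mem_Icc]; omega⟩
      obtain ⟨h, hh, hmax⟩ := exists_max_image (Finset.Icc 1 (H : ℤ))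
        (fun h => Ks s P Q (diffSys d (h * (p : ℤ) ^ r) Φ) qq) hne
      rw [Finset.mem_Icc] at hh
      have hhP : h * (p : ℤ) ^ r ≤ (P : ℤ) - 1 := by
        have hM : (0 : ℤ) < (p : ℤ) ^ r := by positivity
        have e : ((H : ℕ) : ℤ) = ((P : ℤ) - 1) / (p : ℤ) ^ r := by
          rw [hH, Hsh, Int.natCast_div, Nat.cast_sub hP]; simp
        calc h * (p : ℤ) ^ r ≤ (((P : ℤ) - 1) / (p : ℤ) ^ r) * (p : ℤ) ^ r :=
              mul_le_mul_of_nonneg_right (by rw [← e]; exact hh.2) hM.le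
          _ ≤ (P : ℤ) - 1 := Int.ediv_mul_le _ hM.ne'
      have hy0 : (0 : ℤ) ≤ h * (p : ℤ) ^ r := mul_nonneg (by omega) (by positivity)
      have hy1 : (1 : ℤ) ≤ h * (p : ℤ) ^ r := by
        have hM : (1 : ℤ) ≤ (p : ℤ) ^ r := by exact_mod_cast Nat.one_le_pow _ _ hp
        nlinarith
      refine ⟨(h * (p : ℤ) ^ r).toNat, ?_, ?_, fun h' hh' => ?_⟩
      · exact (Int.le_toNat hy0).2 (by exact_mod_cast hy1)
      · exact Int.toNat_le.2 (by linarith)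
      · have e : (((h * (p : ℤ) ^ r).toNat : ℕ) : ℤ) = h * (p : ℤ) ^ r := Int.toNat_of_nonneg hy0
        rw [e]; exact hmax h' hh'
  set Υ := diffSys d (y : ℤ) Φ with hΥ
  have hy0 : y ≠ 0 := by omega
  refine ⟨Υ, ⟨T * y, m, hΦ.diff hT0 hy0, Nat.le_mul_of_pos_right _ (by omega), ?_⟩, ?_⟩
  · rw [mul_comm]; exact Nat.mul_le_mul_right _ hyP
  -- the two counts
  have hL : (Ls s P Q Φ p q r : ℝ) = (U0set s P Q Φ qq p r).card + (U1set s P Q Φ qq p r).card := by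
    rw [Ls_eq_LI, ← hqq, LI_eq_U0_add_U1]; push_cast; rfl
  -- `U₁ ≤ 2^k H^k √(J K⋆)`
  have hU1 : ((U1set s P Q Φ qq p r).card : ℝ) ≤ 2 ^ (k' + 2) * (H : ℝ) ^ (k' + 2) * Real.sqrt (Jv * Ks s P Q Υ qq) := by
    have h1 := card_U1_le_integral s P Q Φ qq p r hp
    have h2 := integral_Gsh_le s P Q Φ qq p r hΦ hpq (by omega : 1 ≤ k' + 2)
    rw [show k' + 2 - 1 = k' + 1 by omega, ← hH] at h2
    have h3 : ∑ h ∈ Finset.Icc 1 (H : ℤ), Real.sqrt (Ks s P Q (diffSys d (h * (p : ℤ) ^ r) Φ) qq) * Real.sqrt Jv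
        ≤ (H : ℝ) * (Real.sqrt (Ks s P Q Υ qq) * Real.sqrt Jv) := by
      calc ∑ h ∈ Finset.Icc 1 (H : ℤ), Real.sqrt (Ks s P Q (diffSys d (h * (p : ℤ) ^ r) Φ) qq) * Real.sqrt Jv
          ≤ ∑ _h ∈ Finset.Icc 1 (H : ℤ), Real.sqrt (Ks s P Q Υ qq) * Real.sqrt Jv := by
            refine sum_le_sum fun h hh => mul_le_mul_of_nonneg_right ?_ (Real.sqrt_nonneg _)
            exact Real.sqrt_le_sqrt (by exact_mod_cast hmax h hh)
        _ = (H : ℝ) * (Real.sqrt (Ks s P Q Υ qq) * Real.sqrt Jv) := by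
            rw [sum_const, Int.card_Icc, nsmul_eq_mul]; simp
    calc ((U1set s P Q Φ qq p r).card : ℝ)
        ≤ 2 ^ (k' + 2) * ((H : ℝ) ^ (k' + 1) * ((H : ℝ) * (Real.sqrt (Ks s P Q Υ qq) * Real.sqrt Jv))) := by
          refine h1.trans (mul_le_mul_of_nonneg_left (h2.trans ?_) (by positivity))
          exact mul_le_mul_of_nonneg_left h3 (by positivity)
      _ = 2 ^ (k' + 2) * (H : ℝ) ^ (k' + 2) * Real.sqrt (Jv * Ks s P Q Υ qq) := by
          rw [Real.sqrt_mul hJ0, pow_succ]; ring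
  -- `U₀ ≤ kP L^{1-1/k} J^{1/k}`
  have hU0 : ((U0set s P Q Φ qq p r).card : ℝ)
      ≤ ((k' : ℝ) + 2) * P * (Ls s P Q Φ p q r : ℝ) ^ (1 - 1 / ((k' : ℝ) + 2)) * Jv ^ (1 / ((k' : ℝ) + 2)) := by
    have h1 := card_U0_le s P Q Φ qq p r (k' + 1)
    have h2 := LI_pred_le s P Q Φ hpq p r hp (k' := k')
    rw [← Ls_eq_LI] at h2
    have h1' : ((U0set s P Q Φ qq p r).card : ℝ) ≤ ((k' : ℝ) + 2) * P * (LI s P Q Φ qq p r (k' + 1) : ℝ) := by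
      have : (U0set s P Q Φ qq p r).card ≤ (k' + 1 + 1) * (P * LI s P Q Φ qq p r (k' + 1)) := h1
      calc ((U0set s P Q Φ qq p r).card : ℝ) ≤ ((k' + 1 + 1 : ℕ) : ℝ) * (P * LI s P Q Φ qq p r (k' + 1) : ℕ) := by
            exact_mod_cast this
        _ = _ := by push_cast; ring
    calc _ ≤ _ := h1'
      _ ≤ ((k' : ℝ) + 2) * P * ((Ls s P Q Φ p q r : ℝ) ^ (1 - 1 / ((k' : ℝ) + 2)) * Jv ^ (1 / ((k' : ℝ) + 2))) :=
          mul_le_mul_of_nonneg_left h2 (by positivity)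
      _ = _ := by ring
  -- assemble: `L ≤ 2 max(U₀, U₁)`
  rcases le_total ((U1set s P Q Φ qq p r).card : ℝ) ((U0set s P Q Φ qq p r).card : ℝ) with hle | hle
  · -- `L ≤ 2U₀`
    refine le_trans ?_ (le_max_left _ _)
    have hL2 : (Ls s P Q Φ p q r : ℝ) ≤ (2 * ((k' : ℝ) + 2) * P) * (Ls s P Q Φ p q r : ℝ) ^ (1 - 1 / ((k' : ℝ) + 2))
        * Jv ^ (1 / ((k' : ℝ) + 2)) := by
      calc (Ls s P Q Φ p q r : ℝ) ≤ 2 * ((U0set s P Q Φ qq p r).card : ℝ) := by rw [hL]; linarith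
        _ ≤ 2 * (((k' : ℝ) + 2) * P * (Ls s P Q Φ p q r : ℝ) ^ (1 - 1 / ((k' : ℝ) + 2)) * Jv ^ (1 / ((k' : ℝ) + 2))) :=
            by linarith
        _ = _ := by ring
    have e : (1 : ℝ) / ((k' : ℝ) + 2) = 1 / ((k' + 2 : ℕ) : ℝ) := by push_cast; ring
    rw [e] at hL2
    exact le_pow_mul_of_le_mul_rpow (k := k' + 2) (by omega) (by positivity) (by positivity) hJ0 hL2
  · -- `L ≤ 2U₁`
    refine le_trans ?_ (le_max_right _ _)
    calc (Ls s P Q Φ p q r : ℝ) ≤ 2 * ((U1set s P Q Φ qq p r).card : ℝ) := by rw [hL]; linarith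
      _ ≤ 2 * (2 ^ (k' + 2) * (H : ℝ) ^ (k' + 2) * Real.sqrt (Jv * Ks s P Q Υ qq)) := by linarith
      _ = _ := by rw [pow_succ]; ring

/-- **Ford's Lemma 3.3 (as printed).** Let `k = k'+2`, `Φ` of type `(d,T)` with `T ≥ 1`, `P ≥ 1`,
`p ≥ 1`, `q ≠ 0`. Then there is a system `Υ` of type `(d+1,T')` with `T ≤ T' ≤ PT` such that
`L_s(P,Q;Φ;p,q,r) ≤ (2P)^k max[k^k J_{s,k}(Q), 2 p^{−rk} (J_{s,k}(Q) K_s(P,Q;Υ;pq))^{1/2}]`.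
(The printed side conditions `s ≥ d`, `k ≥ r ≥ 2`, `d ≤ k−2` and the primality of `p` are not used.)
[cite: Ford2002, Lemma 3.3] -/
theorem ford_lemma33 {k' d : ℕ} (s P Q : ℕ) (hP : 1 ≤ P) (Φ : PSystem (k' + 2)) {T m : ℕ}
    (hΦ : IsType Φ d T m) (hT : 1 ≤ T) {p : ℕ} (hp : 0 < p) {q : ℤ} (hq : q ≠ 0) (r : ℕ) :
    ∃ Υ : PSystem (k' + 2), (∃ T' m', IsType Υ (d + 1) T' m' ∧ T ≤ T' ∧ T' ≤ P * T) ∧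
      (Ls s P Q Φ p q r : ℝ) ≤ (2 * (P : ℝ)) ^ (k' + 2) *
        max (((k' : ℝ) + 2) ^ (k' + 2) * J (k' + 2) s (Finset.Icc 1 (Q : ℤ)))
          (2 * ((p : ℝ) ^ (r * (k' + 2)))⁻¹ *
            Real.sqrt (J (k' + 2) s (Finset.Icc 1 (Q : ℤ)) * Ks s P Q Υ ((p : ℤ) * q))) := by
  obtain ⟨Υ, hΥ, hL⟩ := ford_lemma33_sharp s P Q hP Φ hΦ hT hp hq r
  refine ⟨Υ, hΥ, hL.trans ?_⟩
  have hp0 : (0 : ℝ) < p := by exact_mod_cast hp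
  have hpr : (0 : ℝ) < (p : ℝ) ^ r := pow_pos hp0 r
  -- `H ≤ P / p^r`
  have hH : (Hsh P p r : ℝ) ≤ (P : ℝ) / (p : ℝ) ^ r := by
    rw [le_div_iff₀ hpr]
    have h1 : Hsh P p r * p ^ r ≤ P := (Nat.div_mul_le_self _ _).trans (Nat.sub_le _ _)
    exact_mod_cast h1
  rw [mul_max_of_nonneg _ _ (by positivity)]
  refine max_le_max (le_of_eq (by simp only [mul_pow]; ring)) ?_
  have hH' : (Hsh P p r : ℝ) ^ (k' + 2) ≤ ((P : ℝ) / (p : ℝ) ^ r) ^ (k' + 2) :=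
    pow_le_pow_left₀ (by positivity) hH _
  calc 2 ^ (k' + 3) * (Hsh P p r : ℝ) ^ (k' + 2) * Real.sqrt (J (k' + 2) s (Finset.Icc 1 (Q : ℤ)) * Ks s P Q Υ ((p : ℤ) * q))
      ≤ 2 ^ (k' + 3) * ((P : ℝ) / (p : ℝ) ^ r) ^ (k' + 2) * Real.sqrt (J (k' + 2) s (Finset.Icc 1 (Q : ℤ)) * Ks s P Q Υ ((p : ℤ) * q)) := by
        gcongr
    _ = (2 * (P : ℝ)) ^ (k' + 2) * (2 * ((p : ℝ) ^ (r * (k' + 2)))⁻¹ *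
          Real.sqrt (J (k' + 2) s (Finset.Icc 1 (Q : ℤ)) * Ks s P Q Υ ((p : ℤ) * q))) := by
        rw [div_pow, ← pow_mul, show (2 : ℝ) ^ (k' + 3) = 2 ^ (k' + 2) * 2 from pow_succ 2 (k' + 2)]
        simp only [mul_pow]
        field_simp

end FordVK
end Literature.NumberTheory.LFunctions
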